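import Summits.Parity.GeneralizedHardyLittlewood.Theorems.LeeYangFibresRelativeDimOneMoebiusSplitStubDefs
import Summits.Parity.GeneralizedHardyLittlewood.Theorems.LeeYangFibresRelativeDimOneMoebiusSplitTermBoundAux1
import Literature.NumberTheory.Sieve.LinearEquationsInPrimesDimOne
import Literature.NumberTheory.Sieve.LinearEquationsInPrimesCrudeBounds
import Mathlib
import HarnessLib

/-!
# Route `LeeYangFibres`, crux `RelativeDimOne` (stmt-Parity-14113), line `single-moebius-split`,
# stub `stub_termExpansion` — auxiliary file 5: pointwise expansion of term `j` and crude bounds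

Term `j` of the telescoping,
`T = ∑_{n ∈ K ∩ [−N,N]} [∏_{i<j} Λ(ψ_i(n))] (Λ − Λ_{R_j})(ψ_j(n)) [∏_{i>j} Λ_{R_i}(ψ_i(n))]`
(`telescopeTermSum`, levels `R_i = N^{δ_i}`), is expanded pointwise: the summand vanishes unless every
`ψ_i(n) ≥ 1` (`texp_summand_eq_zero`); the (at most one) point with `ψ_j(n) = 1` costs
`≤ log^k(2LN) · log N · N^{1/4} log^k N ≤ N^{1/2}` (`texp_abs_summand_one_le`, `texp_exceptional_le`,
`texp_eventually_log_pow_le`); for `ψ_j(n) ≥ 2` one opens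
`(Λ − Λ_{R_j})(ψ_j(n)) = −∑_e [e ∣ ψ_j(n), R_j e < ψ_j(n)] μ(ψ_j(n)/e) log(ψ_j(n)/(e R_j))`
(`termBound_aux_vonMangoldt_sub_lambdaR`) and the truncated factors over tuples `d` of divisors
(`prod_Ioi_lambdaR_eq_sum`): this is the registered pointwise identity `texp_summand_expand`. Summed over
the `n` of one divisibility class, the inner sums are the single-Möbius class sums `termClassSum`
(`texp_classSum_eq`). The weights of the tuples are `≤ log^k N` (`texp_abs_wt_le`).
-/

noncomputable section

open scoped BigOperators Classical
open Filter Finset Literature.NumberTheory.Sieve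

namespace Summit.Parity.GeneralizedHardyLittlewood.Cruxes.RelativeDimOne.SingleMoebiusSplit

/-! ### Term `j` as a sum over the integer interval -/

/-- `telescopeTermSum` as a sum over `n ∈ [−N, N] ⊆ ℤ`. -/
theorem texp_telescopeTermSum_eq_sum_Icc {k : ℕ} (Ψ : Fin (k + 1) → AffLinForm 1)
    (K : Set (Fin 1 → ℝ)) (N : ℕ) (R : Fin (k + 1) → ℝ) (j : Fin (k + 1)) :
    telescopeTermSum Ψ K N R j =
      ∑ n ∈ (Finset.Icc (-(N : ℤ)) N).filter (fun n : ℤ => (fun _ : Fin 1 => (n : ℝ)) ∈ K),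
        (∏ i ∈ Finset.Iio j, intVonMangoldt ((Ψ i).eval (fun _ => n))) *
          (intVonMangoldt ((Ψ j).eval (fun _ => n)) - lambdaR (R j) ((Ψ j).eval (fun _ => n))) *
          ∏ i ∈ Finset.Ioi j, lambdaR (R i) ((Ψ i).eval (fun _ => n)) := by
  unfold telescopeTermSum
  rw [sum_filter_latticeBox_dimOne]
  rfl

/-! ### Crude sizes on the box -/

/-- Every coefficient of a non-degenerate `d = 1` system is non-zero. -/
theorem texp_coeff_ne_zero {k : ℕ} {Ψ : Fin (k + 1) → AffLinForm 1} (hΨ : IsNondegenerateSystem Ψ)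
    (i : Fin (k + 1)) : (Ψ i).coeff 0 ≠ 0 := by
  intro h
  apply hΨ.1 i
  funext l
  rw [Fin.fin_one_eq_zero l, Pi.zero_apply]
  exact h

/-- The forms of a non-degenerate `d = 1` system are injective on `ℤ`. -/
theorem texp_eval_injective {k : ℕ} {Ψ : Fin (k + 1) → AffLinForm 1} (hΨ : IsNondegenerateSystem Ψ)
    (i : Fin (k + 1)) {n n' : ℤ} (h : (Ψ i).eval (fun _ => n) = (Ψ i).eval (fun _ => n')) :
    n = n' := by
  have e1 : (Ψ i).eval (fun _ => n) = (Ψ i).coeff 0 * n + (Ψ i).const := DimOne.eval_eq _ _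
  have e2 : (Ψ i).eval (fun _ => n') = (Ψ i).coeff 0 * n' + (Ψ i).const := DimOne.eval_eq _ _
  rw [e1, e2] at h
  have h0 : (Ψ i).coeff 0 * (n - n') = 0 := by linear_combination h
  rcases mul_eq_zero.mp h0 with h0 | h0
  · exact absurd h0 (texp_coeff_ne_zero hΨ i)
  · linarith

/-- `L ≥ 1` for a non-degenerate system of size `≤ L` with at least one form. -/
theorem texp_one_le_of_affLinSize_le {k : ℕ} {Ψ : Fin (k + 1) → AffLinForm 1}
    (hΨ : IsNondegenerateSystem Ψ) {N : ℕ} {L : ℕ} (hL : affLinSize Ψ N ≤ L) : 1 ≤ L := by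
  have h1 := natAbs_coeff_le_of_affLinSize_le hL 0 0
  have h2 := Int.natAbs_pos.mpr (texp_coeff_ne_zero hΨ 0)
  omega

/-- On the box, `|ψ_i(n)| ≤ 2LN`. -/
theorem texp_abs_eval_le {k : ℕ} {Ψ : Fin (k + 1) → AffLinForm 1} {N L : ℕ} (hN : 1 ≤ N)
    (hL : affLinSize Ψ N ≤ L) {n : ℤ} (hn : n ∈ Finset.Icc (-(N : ℤ)) N) (i : Fin (k + 1)) :
    |(((Ψ i).eval (fun _ : Fin 1 => n) : ℤ) : ℝ)| ≤ 2 * L * N := by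
  have hmem : (fun _ : Fin 1 => n) ∈ latticeBox 1 N := Fintype.mem_piFinset.mpr fun _ => hn
  exact abs_eval_le_of_affLinSize_le (L := (L : ℝ)) hN hL hmem i

/-- On the box, `0 ≤ ∏_{i<j} Λ(ψ_i(n)) ≤ log^k(2LN)` (`N ≥ 2`, `L ≥ 1`). -/
theorem texp_prod_Iio_intVonMangoldt_le {k : ℕ} {Ψ : Fin (k + 1) → AffLinForm 1} {N L : ℕ}
    (hN : 2 ≤ N) (hL1 : 1 ≤ L) (hL : affLinSize Ψ N ≤ L) {n : ℤ}
    (hn : n ∈ Finset.Icc (-(N : ℤ)) N) (j : Fin (k + 1)) :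
    0 ≤ ∏ i ∈ Finset.Iio j, intVonMangoldt ((Ψ i).eval (fun _ => n)) ∧
      ∏ i ∈ Finset.Iio j, intVonMangoldt ((Ψ i).eval (fun _ => n)) ≤ Real.log (2 * L * N) ^ k := by
  have hM : (3 : ℝ) ≤ 2 * L * N := by
    have h1 : (1 : ℝ) ≤ L := by exact_mod_cast hL1
    have h2 : (2 : ℝ) ≤ N := by exact_mod_cast hN
    nlinarith
  have hlog1 : 1 ≤ Real.log (2 * L * N) := by
    rw [← Real.log_exp 1]
    refine Real.log_le_log (Real.exp_pos 1) (le_trans ?_ hM)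
    have := Real.exp_one_lt_d9
    norm_num at this ⊢
    linarith
  refine ⟨Finset.prod_nonneg fun i _ => intVonMangoldt_nonneg _, ?_⟩
  calc ∏ i ∈ Finset.Iio j, intVonMangoldt ((Ψ i).eval (fun _ => n))
      ≤ ∏ _i ∈ Finset.Iio j, Real.log (2 * L * N) := by
        refine Finset.prod_le_prod (fun i _ => intVonMangoldt_nonneg _) fun i _ => ?_
        exact intVonMangoldt_le_log (by linarith)
          ((le_abs_self _).trans (texp_abs_eval_le (by omega) hL hn i))
    _ = Real.log (2 * L * N) ^ (Finset.Iio j).card := Finset.prod_const _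
    _ ≤ Real.log (2 * L * N) ^ k := by
        refine pow_le_pow_right₀ hlog1 ?_
        rw [Fin.card_Iio]
        omega

/-- On the box, `|∏_{i>j} Λ_{R_i}(ψ_i(n))| ≤ N^{1/4} log^k N` for levels `R_i = N^{δ_i}`, `δ_i > 0`,
`∑ δ_i ≤ 1/4`, `N ≥ 3` (`|Λ_R| ≤ R log R`). -/
theorem texp_abs_prod_Ioi_lambdaR_le {k : ℕ} {N : ℕ} (hN : 3 ≤ N) {δ : Fin (k + 1) → ℝ}
    (hδ : ∀ i, 0 < δ i) (hsum : ∑ i, δ i ≤ 1 / 4) (j : Fin (k + 1)) (v : Fin (k + 1) → ℤ) :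
    |∏ i ∈ Finset.Ioi j, lambdaR ((N : ℝ) ^ (δ i)) (v i)| ≤
      (N : ℝ) ^ (1 / 4 : ℝ) * Real.log N ^ k := by
  have hN1 : (1 : ℝ) < N := by exact_mod_cast (lt_of_lt_of_le (by norm_num) hN)
  have hN0 : (0 : ℝ) < N := by linarith
  have hlogN : 1 ≤ Real.log N := by
    rw [← Real.log_exp 1]
    refine Real.log_le_log (Real.exp_pos 1) ?_
    have := Real.exp_one_lt_d9
    have h3 : (3 : ℝ) ≤ N := by exact_mod_cast hN
    norm_num at this ⊢
    linarith
  have hδ1 : ∀ i, δ i ≤ 1 := fun i => by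
    have := Finset.single_le_sum (f := δ) (fun i _ => (hδ i).le) (Finset.mem_univ i)
    linarith
  -- each factor: `|Λ_{R_i}| ≤ R_i log R_i ≤ N^{δ_i} log N`
  have hfac : ∀ i, |lambdaR ((N : ℝ) ^ (δ i)) (v i)| ≤ (N : ℝ) ^ (δ i) * Real.log N := by
    intro i
    have hR1 : (1 : ℝ) ≤ (N : ℝ) ^ (δ i) := Real.one_le_rpow hN1.le (hδ i).le
    refine (abs_lambdaR_le hR1 (v i)).trans ?_
    have hfl : (⌊(N : ℝ) ^ (δ i)⌋₊ : ℝ) ≤ (N : ℝ) ^ (δ i) := Nat.floor_le (by positivity)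
    have hlogR : Real.log ((N : ℝ) ^ (δ i)) ≤ Real.log N := by
      rw [Real.log_rpow hN0]
      nlinarith [hδ1 i, hlogN]
    have hlogR0 : 0 ≤ Real.log ((N : ℝ) ^ (δ i)) := Real.log_nonneg hR1
    exact mul_le_mul hfl hlogR hlogR0 (by positivity)
  rw [Finset.abs_prod]
  calc ∏ i ∈ Finset.Ioi j, |lambdaR ((N : ℝ) ^ (δ i)) (v i)|
      ≤ ∏ i ∈ Finset.Ioi j, (N : ℝ) ^ (δ i) * Real.log N :=
        Finset.prod_le_prod (fun i _ => abs_nonneg _) fun i _ => hfac i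
    _ = (N : ℝ) ^ (∑ i ∈ Finset.Ioi j, δ i) * Real.log N ^ (Finset.Ioi j).card := by
        rw [Finset.prod_mul_distrib, Finset.prod_const, Real.rpow_sum_of_pos hN0]
    _ ≤ (N : ℝ) ^ (1 / 4 : ℝ) * Real.log N ^ k := by
        refine mul_le_mul ?_ ?_ (by positivity) (by positivity)
        · refine Real.rpow_le_rpow_of_exponent_le hN1.le ?_
          calc ∑ i ∈ Finset.Ioi j, δ i ≤ ∑ i, δ i :=
                Finset.sum_le_sum_of_subset_of_nonneg (Finset.subset_univ _) fun i _ _ => (hδ i).le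
            _ ≤ 1 / 4 := hsum
        · refine pow_le_pow_right₀ hlogN ?_
          have := Fin.card_Ioi j
          omega

/-- The weights of the tuples: `|∏_{i>j} μ(d_i) log(R_i/d_i)| ≤ log^k N` for
`1 ≤ d_i ≤ R_i = N^{δ_i}`, `N ≥ 3`. -/
theorem texp_abs_wt_le {k : ℕ} {N : ℕ} (hN : 3 ≤ N) {δ : Fin (k + 1) → ℝ} (hδ : ∀ i, 0 < δ i)
    (hsum : ∑ i, δ i ≤ 1 / 4) (j : Fin (k + 1)) {d : Fin (k + 1) → ℕ}
    (hd : d ∈ Fintype.piFinset (fun i => if i ∈ Finset.Ioi j then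
      Finset.Icc 1 ⌊(N : ℝ) ^ (δ i)⌋₊ else {1})) :
    |∏ i ∈ Finset.Ioi j, (((ArithmeticFunction.moebius (d i) : ℤ) : ℝ) *
      Real.log ((N : ℝ) ^ (δ i) / d i))| ≤ Real.log N ^ k := by
  have hN1 : (1 : ℝ) < N := by exact_mod_cast (lt_of_lt_of_le (by norm_num) hN)
  have hN0 : (0 : ℝ) < N := by linarith
  have hlogN : 1 ≤ Real.log N := by
    rw [← Real.log_exp 1]
    refine Real.log_le_log (Real.exp_pos 1) ?_
    have := Real.exp_one_lt_d9
    have h3 : (3 : ℝ) ≤ N := by exact_mod_cast hN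
    norm_num at this ⊢
    linarith
  have hδ1 : ∀ i, δ i ≤ 1 := fun i => by
    have := Finset.single_le_sum (f := δ) (fun i _ => (hδ i).le) (Finset.mem_univ i)
    linarith
  have hfac : ∀ i ∈ Finset.Ioi j, |(((ArithmeticFunction.moebius (d i) : ℤ) : ℝ) *
      Real.log ((N : ℝ) ^ (δ i) / d i))| ≤ Real.log N := by
    intro i hi
    have hdi := Fintype.mem_piFinset.mp hd i
    rw [if_pos hi, Finset.mem_Icc] at hdi
    have hd1 : (1 : ℝ) ≤ d i := by exact_mod_cast hdi.1
    have hdR : (d i : ℝ) ≤ (N : ℝ) ^ (δ i) := (Nat.le_floor_iff (by positivity)).mp hdi.2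
    have hd0 : (0 : ℝ) < d i := by linarith
    have hμ : |((ArithmeticFunction.moebius (d i) : ℤ) : ℝ)| ≤ 1 := by
      rw [← Int.cast_abs]
      exact_mod_cast ArithmeticFunction.abs_moebius_le_one
    have hlog0 : 0 ≤ Real.log ((N : ℝ) ^ (δ i) / d i) :=
      Real.log_nonneg ((one_le_div hd0).mpr hdR)
    have hlog : Real.log ((N : ℝ) ^ (δ i) / d i) ≤ Real.log N := by
      rw [Real.log_div (by positivity) hd0.ne', Real.log_rpow hN0]
      nlinarith [hδ1 i, hlogN, Real.log_nonneg hd1]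
    rw [abs_mul, abs_of_nonneg hlog0]
    calc _ ≤ 1 * Real.log ((N : ℝ) ^ (δ i) / d i) :=
          mul_le_mul hμ le_rfl hlog0 zero_le_one
      _ ≤ Real.log N := by rw [one_mul]; exact hlog
  rw [Finset.abs_prod]
  calc _ ≤ ∏ _i ∈ Finset.Ioi j, Real.log N := Finset.prod_le_prod (fun i _ => abs_nonneg _) hfac
    _ = Real.log N ^ (Finset.Ioi j).card := Finset.prod_const _
    _ ≤ Real.log N ^ k := by
        refine pow_le_pow_right₀ hlogN ?_
        have := Fin.card_Ioi j
        omega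

/-! ### The summand of term `j`: vanishing and the exceptional point -/

/-- The summand of term `j` vanishes unless every `ψ_i(n) ≥ 1` (`Λ`, `Λ − Λ_R` and `Λ_R` all vanish
on non-positive arguments). -/
theorem texp_summand_eq_zero {k : ℕ} (j : Fin (k + 1)) (R : Fin (k + 1) → ℝ)
    (Ψ : Fin (k + 1) → AffLinForm 1) (n : ℤ) (h : ¬ ∀ i, 0 < (Ψ i).eval (fun _ => n)) :
    (∏ i ∈ Finset.Iio j, intVonMangoldt ((Ψ i).eval (fun _ => n))) *
        (intVonMangoldt ((Ψ j).eval (fun _ => n)) - lambdaR (R j) ((Ψ j).eval (fun _ => n))) *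
        ∏ i ∈ Finset.Ioi j, lambdaR (R i) ((Ψ i).eval (fun _ => n)) = 0 := by
  obtain ⟨i, hi⟩ := not_forall.mp h
  have hi' : (Ψ i).eval (fun _ => n) ≤ 0 := not_lt.mp hi
  rcases lt_trichotomy i j with hlt | rfl | hgt
  · rw [Finset.prod_eq_zero (Finset.mem_Iio.mpr hlt) (intVonMangoldt_of_nonpos hi'), zero_mul,
      zero_mul]
  · rw [intVonMangoldt_of_nonpos hi', lambdaR_nonpos _ hi', sub_zero, mul_zero, zero_mul]
  · rw [Finset.prod_eq_zero (Finset.mem_Ioi.mpr hgt) (lambdaR_nonpos _ hi'), mul_zero]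

/-- At a point with `ψ_j(n) = 1` (levels `R_i = N^{δ_i}`, `N ≥ 3`, `L ≥ 1`):
`|F(n)| ≤ log^k(2LN) · log N · (N^{1/4} log^k N)` (`(Λ − Λ_R)(1) = −log R_j`, `log R_j ≤ log N`). -/
theorem texp_abs_summand_one_le {k : ℕ} (j : Fin (k + 1)) {N L : ℕ} (hN : 3 ≤ N) (hL1 : 1 ≤ L)
    {Ψ : Fin (k + 1) → AffLinForm 1} (hL : affLinSize Ψ N ≤ L) {δ : Fin (k + 1) → ℝ}
    (hδ : ∀ i, 0 < δ i) (hsum : ∑ i, δ i ≤ 1 / 4) {n : ℤ} (hn : n ∈ Finset.Icc (-(N : ℤ)) N)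
    (h1 : (Ψ j).eval (fun _ => n) = 1) :
    |(∏ i ∈ Finset.Iio j, intVonMangoldt ((Ψ i).eval (fun _ => n))) *
        (intVonMangoldt ((Ψ j).eval (fun _ => n)) -
          lambdaR ((N : ℝ) ^ (δ j)) ((Ψ j).eval (fun _ => n))) *
        ∏ i ∈ Finset.Ioi j, lambdaR ((N : ℝ) ^ (δ i)) ((Ψ i).eval (fun _ => n))| ≤
      Real.log (2 * L * N) ^ k * Real.log N * ((N : ℝ) ^ (1 / 4 : ℝ) * Real.log N ^ k) := by
  have hN1 : (1 : ℝ) < N := by exact_mod_cast (lt_of_lt_of_le (by norm_num) hN)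
  have hN0 : (0 : ℝ) < N := by linarith
  have hlogN0 : 0 ≤ Real.log N := Real.log_nonneg hN1.le
  have hδ1 : δ j ≤ 1 := by
    have := Finset.single_le_sum (f := δ) (fun i _ => (hδ i).le) (Finset.mem_univ j)
    linarith
  have hRj : (1 : ℝ) ≤ (N : ℝ) ^ (δ j) := Real.one_le_rpow hN1.le (hδ j).le
  have h2LN : (1 : ℝ) ≤ 2 * L * N := by
    have hL1' : (1 : ℝ) ≤ L := by exact_mod_cast hL1
    exact one_le_mul_of_one_le_of_one_le (by linarith) hN1.le
  have ha0 : 0 ≤ Real.log (2 * L * N) ^ k := pow_nonneg (Real.log_nonneg h2LN) k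
  obtain ⟨hA0, hA⟩ := texp_prod_Iio_intVonMangoldt_le (by omega) hL1 hL hn j
  have hB : |intVonMangoldt ((Ψ j).eval (fun _ => n)) -
      lambdaR ((N : ℝ) ^ (δ j)) ((Ψ j).eval (fun _ => n))| ≤ Real.log N := by
    rw [h1, intVonMangoldt_sub_lambdaR_one hRj, abs_neg, Real.log_rpow hN0,
      abs_of_nonneg (mul_nonneg (hδ j).le hlogN0)]
    nlinarith
  have hC := texp_abs_prod_Ioi_lambdaR_le hN hδ hsum j (fun i => (Ψ i).eval (fun _ => n))
  rw [abs_mul, abs_mul, abs_of_nonneg hA0]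
  exact mul_le_mul (mul_le_mul hA hB (abs_nonneg _) ha0) hC (abs_nonneg _) (mul_nonneg ha0 hlogN0)

/-- `2^k (log N)^{2k+1} ≤ N^{1/4}` for all large `N` (`(log x)^r = o(x^s)`). -/
theorem texp_eventually_log_pow_le (k : ℕ) :
    ∀ᶠ N : ℕ in atTop, (2 : ℝ) ^ k * Real.log N ^ (2 * k + 1) ≤ (N : ℝ) ^ (1 / 4 : ℝ) := by
  have hc : (0 : ℝ) < 1 / 2 ^ k := by positivity
  have h := (isLittleO_log_rpow_rpow_atTop ((2 * k + 1 : ℕ) : ℝ)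
    (by norm_num : (0 : ℝ) < 1 / 4)).bound hc
  filter_upwards [tendsto_natCast_atTop_atTop.eventually h, eventually_ge_atTop 1] with N hN hN1
  rw [Real.norm_of_nonneg (Real.rpow_nonneg (Real.log_nonneg (by exact_mod_cast hN1)) _),
    Real.norm_of_nonneg (Real.rpow_nonneg (Nat.cast_nonneg N) _), Real.rpow_natCast] at hN
  have h2 : (0 : ℝ) < 2 ^ k := by positivity
  calc (2 : ℝ) ^ k * Real.log N ^ (2 * k + 1) ≤ 2 ^ k * (1 / 2 ^ k * (N : ℝ) ^ (1 / 4 : ℝ)) :=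
        mul_le_mul_of_nonneg_left hN h2.le
    _ = (N : ℝ) ^ (1 / 4 : ℝ) := by field_simp

/-- The cost of the exceptional point is `≤ N^{1/2}` (and `≥ 0`) once `N ≥ max(3, 2L)` and
`2^k (log N)^{2k+1} ≤ N^{1/4}` (`log(2LN) ≤ 2 log N`). -/
theorem texp_exceptional_le {k N L : ℕ} (hN : 3 ≤ N) (hL1 : 1 ≤ L) (hLN : 2 * L ≤ N)
    (hE : (2 : ℝ) ^ k * Real.log N ^ (2 * k + 1) ≤ (N : ℝ) ^ (1 / 4 : ℝ)) :
    0 ≤ Real.log (2 * L * N) ^ k * Real.log N * ((N : ℝ) ^ (1 / 4 : ℝ) * Real.log N ^ k) ∧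
      Real.log (2 * L * N) ^ k * Real.log N * ((N : ℝ) ^ (1 / 4 : ℝ) * Real.log N ^ k) ≤
        (N : ℝ) ^ (1 / 2 : ℝ) := by
  have hN1 : (1 : ℝ) < N := by exact_mod_cast (lt_of_lt_of_le (by norm_num) hN)
  have hN0 : (0 : ℝ) < N := by linarith
  have hL1' : (1 : ℝ) ≤ L := by exact_mod_cast hL1
  have hLN' : (2 : ℝ) * L ≤ N := by exact_mod_cast hLN
  have hlogN0 : 0 ≤ Real.log N := Real.log_nonneg hN1.le
  have h2LN1 : (1 : ℝ) ≤ 2 * L * N := one_le_mul_of_one_le_of_one_le (by linarith) hN1.le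
  have hlog2LN0 : 0 ≤ Real.log (2 * L * N) := Real.log_nonneg h2LN1
  have hlog2LN : Real.log (2 * L * N) ≤ 2 * Real.log N := by
    have h : (2 : ℝ) * L * N ≤ (N : ℝ) ^ 2 := by nlinarith
    calc Real.log (2 * L * N) ≤ Real.log ((N : ℝ) ^ 2) := Real.log_le_log (by linarith) h
      _ = 2 * Real.log N := by rw [Real.log_pow]; norm_num
  have hc0 : 0 ≤ (N : ℝ) ^ (1 / 4 : ℝ) * Real.log N ^ k :=
    mul_nonneg (Real.rpow_nonneg hN0.le _) (pow_nonneg hlogN0 k)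
  refine ⟨mul_nonneg (mul_nonneg (pow_nonneg hlog2LN0 k) hlogN0) hc0, ?_⟩
  calc Real.log (2 * L * N) ^ k * Real.log N * ((N : ℝ) ^ (1 / 4 : ℝ) * Real.log N ^ k)
      ≤ (2 * Real.log N) ^ k * Real.log N * ((N : ℝ) ^ (1 / 4 : ℝ) * Real.log N ^ k) :=
        mul_le_mul_of_nonneg_right (mul_le_mul_of_nonneg_right
          (pow_le_pow_left₀ hlog2LN0 hlog2LN k) hlogN0) hc0
    _ = (2 : ℝ) ^ k * Real.log N ^ (2 * k + 1) * (N : ℝ) ^ (1 / 4 : ℝ) := by rw [mul_pow]; ring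
    _ ≤ (N : ℝ) ^ (1 / 4 : ℝ) * (N : ℝ) ^ (1 / 4 : ℝ) :=
        mul_le_mul_of_nonneg_right hE (Real.rpow_nonneg hN0.le _)
    _ = (N : ℝ) ^ (1 / 2 : ℝ) := by rw [← Real.rpow_add hN0]; norm_num

/-! ### The pointwise expansion of the summand for `ψ_j(n) ≥ 2` -/

/-- **Pointwise expansion (registered sub-goal, aux 5 for `stub_termExpansion`).** At a point `n`
with `ψ_j(n) ≥ 2` and `ψ_j(n) ≤ R_j · E` (levels `R_i ≥ 0`, `R_j > 0`):
`[∏_{i<j} Λ(ψ_i(n))] (Λ − Λ_{R_j})(ψ_j(n)) [∏_{i>j} Λ_{R_i}(ψ_i(n))] =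
 −∑_{e ≤ E} ∑_d w(d) · [e ∣ ψ_j(n), R_j e < ψ_j(n), ∀ i>j: ψ_i(n) > 0 ∧ d_i ∣ ψ_i(n)]
   μ(ψ_j(n)/e) log(ψ_j(n)/(e R_j)) ∏_{i<j} Λ(ψ_i(n))`, `w(d) = ∏_{i>j} μ(d_i) log(R_i/d_i)`
(`termBound_aux_vonMangoldt_sub_lambdaR` and `prod_Ioi_lambdaR_eq_sum`, multiplied out). -/
theorem texp_summand_expand : ∀ (k : ℕ) (j : Fin (k + 1)) (R : Fin (k + 1) → ℝ),
    (∀ i, 0 ≤ R i) → 0 < R j → ∀ (E : ℕ) (Ψ : Fin (k + 1) → AffLinForm 1) (n : ℤ),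
    2 ≤ (Ψ j).eval (fun _ => n) → (((Ψ j).eval (fun _ => n) : ℤ) : ℝ) ≤ R j * E →
    (∏ i ∈ Finset.Iio j, intVonMangoldt ((Ψ i).eval (fun _ => n))) *
        (intVonMangoldt ((Ψ j).eval (fun _ => n)) - lambdaR (R j) ((Ψ j).eval (fun _ => n))) *
        ∏ i ∈ Finset.Ioi j, lambdaR (R i) ((Ψ i).eval (fun _ => n)) =
      -∑ e ∈ Finset.Icc 1 E, ∑ d ∈ Fintype.piFinset (fun i =>
          if i ∈ Finset.Ioi j then Finset.Icc 1 ⌊R i⌋₊ else {1}),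
        (∏ i ∈ Finset.Ioi j, (((ArithmeticFunction.moebius (d i) : ℤ) : ℝ) *
          Real.log (R i / d i))) *
        (if ((e : ℤ) ∣ (Ψ j).eval (fun _ => n) ∧ R j * e < (((Ψ j).eval (fun _ => n) : ℤ) : ℝ) ∧
              ∀ i ∈ Finset.Ioi j, (0 < (Ψ i).eval (fun _ => n) ∧
                ((d i : ℕ) : ℤ) ∣ (Ψ i).eval (fun _ => n)))
          then (ArithmeticFunction.moebius (((Ψ j).eval (fun _ => n)) / e).toNat : ℝ) *
              Real.log ((((Ψ j).eval (fun _ => n) : ℤ) : ℝ) / (e * R j)) *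
              ∏ i ∈ Finset.Iio j, intVonMangoldt ((Ψ i).eval (fun _ => n))
          else 0) := by
  intro k j R hR hRj E Ψ n h2 hE
  have hprod := prod_Ioi_lambdaR_eq_sum j R hR (fun i => (Ψ i).eval (fun _ => n))
  rw [termBound_aux_vonMangoldt_sub_lambdaR (R j) hRj _ h2 E hE, hprod]
  have hneg : ∀ (F S T : ℝ), F * (-S) * T = -(F * S * T) := fun _ _ _ => by ring
  rw [hneg, neg_inj, mul_assoc, Finset.sum_mul, Finset.mul_sum]
  refine Finset.sum_congr rfl fun e _ => ?_
  rw [Finset.mul_sum, Finset.mul_sum]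
  refine Finset.sum_congr rfl fun d _ => ?_
  by_cases hA : ((e : ℤ) ∣ (Ψ j).eval (fun _ => n) ∧ R j * e < (((Ψ j).eval (fun _ => n) : ℤ) : ℝ))
  · by_cases hB : ∀ i ∈ Finset.Ioi j, (0 < (Ψ i).eval (fun _ => n) ∧
        ((d i : ℕ) : ℤ) ∣ (Ψ i).eval (fun _ => n))
    · rw [if_pos hA, if_pos hB, if_pos ⟨hA.1, hA.2, hB⟩]
      ring
    · rw [if_pos hA, if_neg hB, if_neg (fun h => hB h.2.2)]
      ring
  · rw [if_neg hA, zero_mul, mul_zero, if_neg (fun h => hA ⟨h.1, h.2.1⟩), mul_zero]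

/-- Off `ψ_j(n) ≥ 2` the class-sum indicator fails: `R_j e ≥ 1 ≥ ψ_j(n)` (`R_j, e ≥ 1`). -/
theorem texp_two_le_of_lt {Rj : ℝ} (hRj : 1 ≤ Rj) {e : ℕ} (he : 1 ≤ e) {m : ℤ}
    (hlt : Rj * e < (m : ℝ)) : 2 ≤ m := by
  have he1 : (1 : ℝ) ≤ e := by exact_mod_cast he
  have h1 : (1 : ℝ) < m := by nlinarith
  have h1' : (1 : ℤ) < m := by exact_mod_cast h1
  omega

/-! ### The class sums -/

/-- **Identification of the class sums.** Summed over the `n ∈ [−N, N]` with `(n) ∈ K`, all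
`ψ_i(n) > 0` and `ψ_j(n) ≠ 1`, the indicator-weighted summand of `texp_summand_expand` at `(d, e)` is
the single-Möbius class sum `termClassSum Ψ K N R_j j d e` (`R_j e < ψ_j(n)` forces `ψ_j(n) ≥ 2`). -/
theorem texp_classSum_eq {k : ℕ} (Ψ : Fin (k + 1) → AffLinForm 1) (K : Set (Fin 1 → ℝ)) (N : ℕ)
    {Rj : ℝ} (hRj : 1 ≤ Rj) (j : Fin (k + 1)) (d : Fin (k + 1) → ℕ) {e : ℕ} (he : 1 ≤ e)
    {S : Finset ℤ} (hS : ∀ n, n ∈ S ↔ n ∈ Finset.Icc (-(N : ℤ)) N ∧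
      (fun _ : Fin 1 => (n : ℝ)) ∈ K ∧ (∀ i, 0 < (Ψ i).eval (fun _ => n)) ∧
      (Ψ j).eval (fun _ => n) ≠ 1) :
    ∑ n ∈ S, (if ((e : ℤ) ∣ (Ψ j).eval (fun _ => n) ∧
          Rj * e < (((Ψ j).eval (fun _ => n) : ℤ) : ℝ) ∧
          ∀ i ∈ Finset.Ioi j, (0 < (Ψ i).eval (fun _ => n) ∧
            ((d i : ℕ) : ℤ) ∣ (Ψ i).eval (fun _ => n)))
        then (ArithmeticFunction.moebius (((Ψ j).eval (fun _ => n)) / e).toNat : ℝ) *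
            Real.log ((((Ψ j).eval (fun _ => n) : ℤ) : ℝ) / (e * Rj)) *
            ∏ i ∈ Finset.Iio j, intVonMangoldt ((Ψ i).eval (fun _ => n))
        else 0) = termClassSum Ψ K N Rj j d e := by
  unfold termClassSum
  rw [← Finset.sum_filter]
  refine Finset.sum_congr ?_ (fun _ _ => rfl)
  ext n
  simp only [Finset.mem_filter, hS]
  constructor
  · rintro ⟨⟨hn, hK, hpos, -⟩, hdvd, hlt, hIoi⟩
    exact ⟨hn, hK, hpos, fun i hi => (hIoi i hi).2, hdvd, hlt⟩
  · rintro ⟨hn, hK, hpos, hIoi, hdvd, hlt⟩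
    refine ⟨⟨hn, hK, hpos, ?_⟩, hdvd, hlt, fun i hi => ⟨hpos i, hIoi i hi⟩⟩
    have := texp_two_le_of_lt hRj he hlt
    omega

end Summit.Parity.GeneralizedHardyLittlewood.Cruxes.RelativeDimOne.SingleMoebiusSplit
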